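import Literature.AlgebraicGeometry.Motives.HodgeLieDiagonal
import Mathlib.Algebra.Lie.OfAssociative
import Mathlib.Algebra.Lie.Semisimple.Defs
import HarnessLib

/-!
# The Hodge Lie algebra up to isomorphism of LIE ALGEBRAS: `𝔥(e^* H) ≅ 𝔥(H)` (conjugation) and `𝔥(H) ≅ 𝔥(H^{⊕ι})` (the diagonal)

Family `hodge`, layer `Literature/AlgebraicGeometry/Motives`; THEOREMS ONLY (no definition, no named fact; net debt 0).
Written for the cell `pub-hodgecm2` (COR-CM), seat `b27` gen 43 (count-neutral Mumford–Tate-rank ladder).  Sequel of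
`Motives/HodgeLieDirectSum` (gen 35: `e⁻¹ 𝔥(H) e ⊆ 𝔥(e^* H)`, `e 𝔥(e^* H) e⁻¹ ⊆ 𝔥(H)`, `dim 𝔥(e^* H) = dim 𝔥(H)`) and of
`Motives/HodgeLieDiagonal` (gen 42: `𝔥(H^{⊕ι}) = Δ 𝔥(H)`, `dim 𝔥(H^{⊕ι}) = dim 𝔥(H)`), which compared the Lie algebras of
the Hodge groups only as `ℚ`-SUBSPACES of `End` (as does `Motives/MumfordTateRankInvariance` for the Mumford–Tate twin
`𝔪𝔱(e^* H) = e⁻¹ 𝔪𝔱(H) e`, and `Motives/MumfordTateGroupTransport` for the groups of `ℚ`-points).  Here the comparison maps — conjugation `Y ↦ e Y e⁻¹` and the diagonal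
`Y ↦ Δ(Y) = Σ_i in_i Y pr_i` — are shown to be ISOMORPHISMS OF LIE ALGEBRAS (they are restrictions of homomorphisms of
associative algebras `End V → End W`, `End V → End V^{⊕ι}`), so that every Lie-theoretic invariant of `𝔥` (simplicity,
commutativity, semisimplicity, the isomorphism class itself) is an invariant of the isomorphism class of the Hodge
structure and does not change under `H ↦ H^{⊕ι}`.  This is the Lie-algebra content of Moonen's «if `φ : V → W` is an
isomorphism of Hodge structures then `MT(W) = φ MT(V) φ⁻¹`» and «`MT(V^{⊕n})` (`n ≥ 1`) is isomorphic to `MT(V)` acting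
diagonally on `V^{⊕n}`» [Moonen 1999 (1.7)–(1.8); Moonen 2004 §4 (4.6), Exercise (4.10)]; for complex abelian varieties
(`Motives/HodgeLieOfAbelianVarietyLieEquiv`): `Lie Hg(H¹X) ≅ Lie Hg(H¹X')` for `X ∼ X'` and `Lie Hg(H¹(Bⁿ)) ≅ Lie Hg(H¹B)`
(Moonen–Zarhin 1999 §1: «we can identify `Hg(Xⁿ)` with `Hg(X)` acting diagonally»).

Lie subalgebras of `End_ℚ` carry Mathlib's commutator bracket `LieRing.ofAssociativeRing` (a non-instance `def`, supplied
by a `letI` in each statement, as in `Motives/HodgeLieDerivedSemisimple`); a statement «for every Lie subalgebra `𝔏` with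
carrier `𝔥(H)`» is the tree's idiom for «the Lie algebra `𝔥(H)`» (`exists_lieSubalgebra_eq_hodgeLie`).

* §1 `exists_lieSubalgebra_eq_hodgeLie` — `𝔥(H)` is (the carrier of) a Lie subalgebra of `𝔤𝔩(V)`.
* §2 TRANSPORT ALONG `e : V ≃ W`: `hodgeLie_comapEquiv_eq_map_conj` (`𝔥(e^* H) = e⁻¹ 𝔥(H) e` as subspaces),
  **`exists_lieEquiv_of_eq_hodgeLie_comapEquiv`** (`Y ↦ e Y e⁻¹ : 𝔥(e^* H) ≃ₗ⁅ℚ⁆ 𝔥(H)`),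
  `isSimple_iff_of_eq_hodgeLie_comapEquiv`, `isLieAbelian_iff_of_eq_hodgeLie_comapEquiv`.
* §3 THE DIAGONAL: **`exists_lieEquiv_of_eq_hodgeLie_pi_const`** (`Y ↦ Δ(Y) : 𝔥(H) ≃ₗ⁅ℚ⁆ 𝔥(H^{⊕ι})`, `ι` finite nonempty,
  with `Δ(Y) v = (Y v_i)_i`), `isSimple_iff_of_eq_hodgeLie_pi_const`, `isLieAbelian_iff_of_eq_hodgeLie_pi_const`.

## References
* [Moonen1999MTNotes] B. Moonen, *Notes on Mumford–Tate groups* (Centre Émile Borel, 1999), (1.7) («`MT(W) = φ MT(V) φ⁻¹`»)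
  and (1.8) («`MT(V^{⊕n})` is isomorphic to `MT(V)` acting diagonally»). [cite: Moonen1999MTNotes, (1.7) and (1.8)]
* [Moonen2004MT] B. Moonen, *An introduction to Mumford–Tate groups* (2004), §4 (4.6) and Exercise (4.10).
  [cite: Moonen2004MT, §4 (4.6) and Exercise 4.10]
* [MoonenZarhin1999LowDim] B. Moonen, Yu. Zarhin, *Hodge classes on abelian varieties of low dimension*, Math. Ann. 315
  (1999), §1 [corpus: paper:arxiv-math_9901113 p. 2]. [cite: MoonenZarhin1999LowDim, §1]
* [Deligne1982HodgeCycles] P. Deligne, *Hodge cycles on abelian varieties*, LNM 900 (1982), I §3.1 and Prop. 3.4.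
  [cite: Deligne1982HodgeCycles, I §3.1 and Prop. 3.4]
* [Hall2015] B. Hall, *Lie Groups, Lie Algebras, and Representations*, 2nd ed., §3.2 (isomorphic Lie algebras).
-/

noncomputable section

namespace Literature.AlgebraicGeometry.Motives

namespace HodgeStructure

/-! ### §0 Simplicity along isomorphisms of Lie algebras -/

/-- Simplicity is invariant under isomorphisms of Lie algebras (ideals correspond under `e`; `e` is injective and
preserves brackets).  Private copy of the tree's `Literature.Algebra.Lie.SimpleBaseChange.isSimple_of_lieEquiv`, to keep
this file's imports inside `Motives/`. [cite: Hall2015, §3.2 Definition 3.11] -/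
private theorem isSimple_of_lieEquiv {R L L' : Type*} [CommRing R] [LieRing L] [LieAlgebra R L] [LieRing L']
    [LieAlgebra R L'] (e : L ≃ₗ⁅R⁆ L') [LieAlgebra.IsSimple R L'] : LieAlgebra.IsSimple R L := by
  -- adapted from Literature/Algebra/Lie/SimpleBaseChange.lean (`isSimple_of_lieEquiv`)
  refine ⟨fun I => ?_, fun hab => ?_⟩
  · rcases LieAlgebra.IsSimple.eq_bot_or_eq_top (LieIdeal.comap (e.symm : L' →ₗ⁅R⁆ L) I) with h | h
    · left
      rw [eq_bot_iff]
      intro x hx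
      have hx' : e x ∈ LieIdeal.comap (e.symm : L' →ₗ⁅R⁆ L) I := by
        rw [LieIdeal.mem_comap]
        change e.symm (e x) ∈ I
        rw [e.symm_apply_apply]; exact hx
      rw [h, LieSubmodule.mem_bot] at hx'
      rw [LieSubmodule.mem_bot, ← e.symm_apply_apply x, hx', map_zero]
    · right
      rw [eq_top_iff]
      intro x _
      have hx' : e x ∈ LieIdeal.comap (e.symm : L' →ₗ⁅R⁆ L) I := by rw [h]; exact LieSubmodule.mem_top _
      rw [LieIdeal.mem_comap] at hx'
      change e.symm (e x) ∈ I at hx'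
      rw [e.symm_apply_apply] at hx'
      exact hx'
  · haveI := hab
    refine LieAlgebra.IsSimple.non_abelian R (L := L') ⟨fun x y => ?_⟩
    rw [← e.apply_symm_apply x, ← e.apply_symm_apply y, ← e.map_lie, trivial_lie_zero, map_zero]

/-! ### §1 `𝔥(H)` as a Lie subalgebra of `𝔤𝔩(V)` -/

section Subalgebra

universe u

variable {V : Type u} [AddCommGroup V] [Module ℚ V] [Module.Finite ℚ V] [HodgeTensorFacts.{u, u}] {n : ℤ}

/-- `𝔥(H) = hodgeLie H` is (the carrier of) a Lie subalgebra of `𝔤𝔩(V) = End_ℚ(V)` with the commutator bracket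
(`commutator_mem_hodgeLie`). [cite: Deligne1982HodgeCycles, I §3.1 and Prop. 3.4] -/
theorem exists_lieSubalgebra_eq_hodgeLie (H : HodgeStructure V n) :
    letI : LieRing (Module.End ℚ V) := LieRing.ofAssociativeRing
    ∃ 𝔏 : LieSubalgebra ℚ (Module.End ℚ V), 𝔏.toSubmodule = H.hodgeLie :=
  letI : LieRing (Module.End ℚ V) := LieRing.ofAssociativeRing
  ⟨{ H.hodgeLie with
      lie_mem' := fun {a b} ha hb => by
        rw [LieRing.of_associative_ring_bracket]
        exact H.commutator_mem_hodgeLie ha hb }, rfl⟩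

end Subalgebra

/-! ### §2 Transport along a linear equivalence `e : V ≃ W`: `𝔥(e^* H) ≅ 𝔥(H)` by conjugation -/

section Transport

universe u

variable {V : Type u} [AddCommGroup V] [Module ℚ V] [Module.Finite ℚ V]
  {W : Type u} [AddCommGroup W] [Module ℚ W] [Module.Finite ℚ W] [HodgeTensorFacts.{u, u}] {n : ℤ}

/-- **`𝔥(e^* H) = e⁻¹ 𝔥(H) e` as subspaces of `End_ℚ(V)`**, for a linear equivalence `e : V ≃ W` and the transported Hodge
structure `e^* H = H.comapEquiv e` (the two inclusions are the tree's `conj_symm_mem_hodgeLie_comapEquiv`,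
`conj_mem_hodgeLie_of_mem_hodgeLie_comapEquiv`). Lie form of «`MT(W) = φ MT(V) φ⁻¹` for an isomorphism `φ` of Hodge
structures». [cite: Moonen1999MTNotes, (1.7) and (1.8)] [cite: Deligne1982HodgeCycles, I §3.1 and Prop. 3.4] -/
theorem hodgeLie_comapEquiv_eq_map_conj (H : HodgeStructure W n) (e : V ≃ₗ[ℚ] W) :
    (H.comapEquiv e).hodgeLie =
      H.hodgeLie.map (e.symm.conj : Module.End ℚ W ≃ₗ[ℚ] Module.End ℚ V).toLinearMap := by
  refine le_antisymm (fun Y hY => ?_) ?_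
  · refine ⟨e.toLinearMap ∘ₗ Y ∘ₗ e.symm.toLinearMap, conj_mem_hodgeLie_of_mem_hodgeLie_comapEquiv H e hY, ?_⟩
    change e.symm.conj _ = Y
    rw [LinearEquiv.conj_apply, LinearEquiv.symm_symm]
    ext v
    simp only [LinearMap.coe_comp, LinearEquiv.coe_coe, Function.comp_apply, LinearEquiv.symm_apply_apply]
  · rintro _ ⟨X, hX, rfl⟩
    have h := conj_symm_mem_hodgeLie_comapEquiv H e hX
    change e.symm.conj X ∈ _
    rw [LinearEquiv.conj_apply, LinearEquiv.symm_symm, LinearMap.comp_assoc]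
    exact h

/-- **Conjugation `Y ↦ e Y e⁻¹` is an isomorphism of Lie algebras `𝔥(e^* H) ≃ₗ⁅ℚ⁆ 𝔥(H)`** (for every choice of Lie
subalgebras `𝔏 ≤ 𝔤𝔩(V)`, `𝔏' ≤ 𝔤𝔩(W)` with carriers `𝔥(e^* H)`, `𝔥(H)`): the restriction of Mathlib's `LinearEquiv.lieConj`.
Lie-algebra form of Moonen's (1.7) «`MT(W) = φ MT(V) φ⁻¹`». [cite: Moonen1999MTNotes, (1.7) and (1.8)]
[cite: Moonen2004MT, §4 (4.6) and Exercise 4.10] [cite: Deligne1982HodgeCycles, I §3.1 and Prop. 3.4] -/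
theorem exists_lieEquiv_of_eq_hodgeLie_comapEquiv (H : HodgeStructure W n) (e : V ≃ₗ[ℚ] W) :
    letI : LieRing (Module.End ℚ V) := LieRing.ofAssociativeRing
    letI : LieRing (Module.End ℚ W) := LieRing.ofAssociativeRing
    ∀ (𝔏 : LieSubalgebra ℚ (Module.End ℚ V)) (𝔏' : LieSubalgebra ℚ (Module.End ℚ W)),
      𝔏.toSubmodule = (H.comapEquiv e).hodgeLie → 𝔏'.toSubmodule = H.hodgeLie →
      ∃ Φ : 𝔏 ≃ₗ⁅ℚ⁆ 𝔏', ∀ Y : 𝔏,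
        ((Φ Y : 𝔏') : Module.End ℚ W) = e.toLinearMap ∘ₗ (Y : Module.End ℚ V) ∘ₗ e.symm.toLinearMap := by
  letI : LieRing (Module.End ℚ V) := LieRing.ofAssociativeRing
  letI : LieRing (Module.End ℚ W) := LieRing.ofAssociativeRing
  intro 𝔏 𝔏' h𝔏 h𝔏'
  have hmap : 𝔏.map (e.lieConj : Module.End ℚ V →ₗ⁅ℚ⁆ Module.End ℚ W) = 𝔏' := by
    ext X
    rw [LieSubalgebra.mem_map]
    constructor
    · rintro ⟨Y, hY, rfl⟩
      have hY' : Y ∈ (H.comapEquiv e).hodgeLie := by rw [← h𝔏]; exact hY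
      rw [← LieSubalgebra.mem_toSubmodule, h𝔏']
      change e.lieConj Y ∈ H.hodgeLie
      rw [LinearEquiv.lieConj_apply, LinearEquiv.conj_apply, LinearMap.comp_assoc]
      exact conj_mem_hodgeLie_of_mem_hodgeLie_comapEquiv H e hY'
    · intro hX
      have hX' : X ∈ H.hodgeLie := by rw [← h𝔏']; exact hX
      refine ⟨e.symm.toLinearMap ∘ₗ X ∘ₗ e.toLinearMap, ?_, ?_⟩
      · rw [← LieSubalgebra.mem_toSubmodule, h𝔏]
        exact conj_symm_mem_hodgeLie_comapEquiv H e hX'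
      · change e.lieConj _ = X
        rw [LinearEquiv.lieConj_apply, LinearEquiv.conj_apply]
        ext v
        simp only [LinearMap.coe_comp, LinearEquiv.coe_coe, Function.comp_apply, LinearEquiv.apply_symm_apply]
  refine ⟨LieEquiv.ofSubalgebras 𝔏 𝔏' e.lieConj hmap, fun Y => ?_⟩
  rw [LieEquiv.ofSubalgebras_apply, LinearEquiv.lieConj_apply, LinearEquiv.conj_apply, LinearMap.comp_assoc]

/-- **Simplicity of the Hodge Lie algebra is an invariant of the isomorphism class of the Hodge structure**:
`𝔥(e^* H)` is a simple Lie algebra over `ℚ` iff `𝔥(H)` is. [cite: Moonen1999MTNotes, (1.7) and (1.8)] -/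
theorem isSimple_iff_of_eq_hodgeLie_comapEquiv (H : HodgeStructure W n) (e : V ≃ₗ[ℚ] W) :
    letI : LieRing (Module.End ℚ V) := LieRing.ofAssociativeRing
    letI : LieRing (Module.End ℚ W) := LieRing.ofAssociativeRing
    ∀ (𝔏 : LieSubalgebra ℚ (Module.End ℚ V)) (𝔏' : LieSubalgebra ℚ (Module.End ℚ W)),
      𝔏.toSubmodule = (H.comapEquiv e).hodgeLie → 𝔏'.toSubmodule = H.hodgeLie →
      (LieAlgebra.IsSimple ℚ 𝔏 ↔ LieAlgebra.IsSimple ℚ 𝔏') := by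
  intro 𝔏 𝔏' h𝔏 h𝔏'
  obtain ⟨Φ, -⟩ := exists_lieEquiv_of_eq_hodgeLie_comapEquiv H e 𝔏 𝔏' h𝔏 h𝔏'
  exact ⟨fun _ => isSimple_of_lieEquiv Φ.symm, fun _ => isSimple_of_lieEquiv Φ⟩

/-- **Commutativity of the Hodge Lie algebra is an invariant of the isomorphism class of the Hodge structure**:
`𝔥(e^* H)` is abelian iff `𝔥(H)` is. [cite: Moonen1999MTNotes, (1.7) and (1.8)] -/
theorem isLieAbelian_iff_of_eq_hodgeLie_comapEquiv (H : HodgeStructure W n) (e : V ≃ₗ[ℚ] W) :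
    letI : LieRing (Module.End ℚ V) := LieRing.ofAssociativeRing
    letI : LieRing (Module.End ℚ W) := LieRing.ofAssociativeRing
    ∀ (𝔏 : LieSubalgebra ℚ (Module.End ℚ V)) (𝔏' : LieSubalgebra ℚ (Module.End ℚ W)),
      𝔏.toSubmodule = (H.comapEquiv e).hodgeLie → 𝔏'.toSubmodule = H.hodgeLie →
      (IsLieAbelian 𝔏 ↔ IsLieAbelian 𝔏') := by
  intro 𝔏 𝔏' h𝔏 h𝔏'
  obtain ⟨Φ, -⟩ := exists_lieEquiv_of_eq_hodgeLie_comapEquiv H e 𝔏 𝔏' h𝔏 h𝔏'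
  exact ⟨fun h => Φ.symm.injective.isLieAbelian h, fun h => Φ.injective.isLieAbelian h⟩

end Transport

/-! ### §3 The diagonal `𝔥(H) ≅ 𝔥(H^{⊕ι})` -/

section PiConst

universe u

variable {ι : Type} [Fintype ι] [DecidableEq ι] {V : Type u} [AddCommGroup V] [Module ℚ V] [Module.Finite ℚ V]
  [HodgeTensorFacts.{u, u}] {n : ℤ} (H : HodgeStructure V n)

omit [Module.Finite ℚ V] [HodgeTensorFacts.{u, u}] in
/-- The diagonal operator `Δ(Y) = Σ_i in_i ∘ Y ∘ pr_i` of `V^{⊕ι}` acts coordinatewise: `Δ(Y) v = (Y v_i)_i`. [folklore] -/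
private theorem sum_single_comp_comp_proj_apply (Y : Module.End ℚ V) (v : ι → V) :
    (∑ i, LinearMap.single ℚ (fun _ : ι => V) i ∘ₗ Y ∘ₗ LinearMap.proj i) v = fun i => Y (v i) := by
  simp only [LinearMap.sum_apply, LinearMap.comp_apply, LinearMap.coe_single, LinearMap.proj_apply]
  exact Finset.univ_sum_single _

omit [Module.Finite ℚ V] [HodgeTensorFacts.{u, u}] in
/-- `Δ` is multiplicative: `Δ(X Y) = Δ(X) Δ(Y)`. [folklore] -/
private theorem sum_single_comp_comp_proj_mul (X Y : Module.End ℚ V) :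
    (∑ i, LinearMap.single ℚ (fun _ : ι => V) i ∘ₗ (X * Y) ∘ₗ LinearMap.proj i) =
      (∑ i, LinearMap.single ℚ (fun _ : ι => V) i ∘ₗ X ∘ₗ LinearMap.proj i) *
        ∑ i, LinearMap.single ℚ (fun _ : ι => V) i ∘ₗ Y ∘ₗ LinearMap.proj i := by
  refine LinearMap.ext fun v => ?_
  rw [Module.End.mul_apply, sum_single_comp_comp_proj_apply, sum_single_comp_comp_proj_apply,
    sum_single_comp_comp_proj_apply]
  rfl

omit [Module.Finite ℚ V] [HodgeTensorFacts.{u, u}] in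
/-- The diagonal block of `Δ(Y)` is `Y`: `pr_j Δ(Y) in_j = Y`. [folklore] -/
private theorem proj_comp_sum_single_comp_comp_proj_comp_single (Y : Module.End ℚ V) (j : ι) :
    LinearMap.proj j ∘ₗ (∑ i, LinearMap.single ℚ (fun _ : ι => V) i ∘ₗ Y ∘ₗ LinearMap.proj i) ∘ₗ
      LinearMap.single ℚ (fun _ : ι => V) j = Y := by
  refine LinearMap.ext fun v => ?_
  rw [LinearMap.comp_apply, LinearMap.comp_apply, sum_single_comp_comp_proj_apply]
  simp only [LinearMap.proj_apply, LinearMap.coe_single, Pi.single_eq_same]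

/-- **The diagonal `Y ↦ Δ(Y) = Σ_i in_i Y pr_i` is an isomorphism of Lie algebras `𝔥(H) ≃ₗ⁅ℚ⁆ 𝔥(H^{⊕ι})`** for `ι` finite
nonempty (for every choice of Lie subalgebras `𝔏 ≤ 𝔤𝔩(V)`, `𝔏' ≤ 𝔤𝔩(V^{⊕ι})` with carriers `𝔥(H)`, `𝔥(⊕_ι H)`): `Δ` is a
homomorphism of associative algebras, it maps `𝔥(H)` into `𝔥(H^{⊕ι})` (`sum_single_comp_comp_proj_mem_hodgeLie_pi_const`),
injectively (`pr_j Δ(Y) in_j = Y`) and onto (`eq_sum_single_comp_comp_proj_of_mem_hodgeLie_pi_const`).  Lie-algebra form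
of «`MT(V^{⊕n})` is isomorphic to `MT(V)` acting diagonally on `V^{⊕n}`». [cite: Moonen1999MTNotes, (1.7) and (1.8)]
[cite: Moonen2004MT, §4 (4.6) and Exercise 4.10] [cite: MoonenZarhin1999LowDim, §1] -/
theorem exists_lieEquiv_of_eq_hodgeLie_pi_const [Nonempty ι] :
    letI : LieRing (Module.End ℚ V) := LieRing.ofAssociativeRing
    letI : LieRing (Module.End ℚ (ι → V)) := LieRing.ofAssociativeRing
    ∀ (𝔏 : LieSubalgebra ℚ (Module.End ℚ V)) (𝔏' : LieSubalgebra ℚ (Module.End ℚ (ι → V))),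
      𝔏.toSubmodule = H.hodgeLie → 𝔏'.toSubmodule = (pi fun _ : ι => H).hodgeLie →
      ∃ Δ : 𝔏 ≃ₗ⁅ℚ⁆ 𝔏', ∀ Y : 𝔏,
        ((Δ Y : 𝔏') : Module.End ℚ (ι → V)) =
          ∑ i, LinearMap.single ℚ (fun _ : ι => V) i ∘ₗ (Y : Module.End ℚ V) ∘ₗ LinearMap.proj i := by
  letI : LieRing (Module.End ℚ V) := LieRing.ofAssociativeRing
  letI : LieRing (Module.End ℚ (ι → V)) := LieRing.ofAssociativeRing
  intro 𝔏 𝔏' h𝔏 h𝔏'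
  obtain ⟨j₀⟩ := ‹Nonempty ι›
  have hmem : ∀ Y : 𝔏, (∑ i, LinearMap.single ℚ (fun _ : ι => V) i ∘ₗ (Y : Module.End ℚ V) ∘ₗ LinearMap.proj i) ∈ 𝔏' :=
    fun Y => by
      rw [← LieSubalgebra.mem_toSubmodule, h𝔏']
      refine sum_single_comp_comp_proj_mem_hodgeLie_pi_const H ?_
      rw [← h𝔏]; exact Y.2
  let Δ₀ : Module.End ℚ V →ₗ[ℚ] Module.End ℚ (ι → V) :=
    { toFun := fun Y => ∑ i, LinearMap.single ℚ (fun _ : ι => V) i ∘ₗ Y ∘ₗ LinearMap.proj i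
      map_add' := fun Y Z => by
        simp only [LinearMap.comp_add, LinearMap.add_comp, Finset.sum_add_distrib]
      map_smul' := fun c Y => by
        simp only [LinearMap.comp_smul, LinearMap.smul_comp, RingHom.id_apply, Finset.smul_sum] }
  have hΔ₀ : ∀ Y, Δ₀ Y = ∑ i, LinearMap.single ℚ (fun _ : ι => V) i ∘ₗ Y ∘ₗ LinearMap.proj i := fun _ => rfl
  have hΔ₀mul : ∀ X Y, Δ₀ (X * Y) = Δ₀ X * Δ₀ Y := fun X Y => by
    rw [hΔ₀, hΔ₀, hΔ₀]; exact sum_single_comp_comp_proj_mul X Y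
  let Δ : 𝔏 →ₗ⁅ℚ⁆ 𝔏' :=
    { toFun := fun Y => ⟨Δ₀ Y, hmem Y⟩
      map_add' := fun Y Z => Subtype.ext (by
        change Δ₀ ((Y : Module.End ℚ V) + Z) = Δ₀ Y + Δ₀ Z
        exact map_add Δ₀ _ _)
      map_smul' := fun c Y => Subtype.ext (by
        change Δ₀ (c • (Y : Module.End ℚ V)) = c • Δ₀ Y
        exact map_smul Δ₀ _ _)
      map_lie' := fun {Y Z} => Subtype.ext (by
        change Δ₀ ((Y : Module.End ℚ V) * Z - Z * Y) = Δ₀ Y * Δ₀ Z - Δ₀ Z * Δ₀ Y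
        rw [map_sub, hΔ₀mul, hΔ₀mul]) }
  have hΔ : ∀ Y : 𝔏, ((Δ Y : 𝔏') : Module.End ℚ (ι → V)) =
      ∑ i, LinearMap.single ℚ (fun _ : ι => V) i ∘ₗ (Y : Module.End ℚ V) ∘ₗ LinearMap.proj i := fun _ => rfl
  have hinj : Function.Injective Δ := fun Y Z hYZ => by
    have h := congrArg (fun X : 𝔏' => (X : Module.End ℚ (ι → V))) hYZ
    simp only [hΔ] at h
    refine Subtype.ext ?_
    rw [← proj_comp_sum_single_comp_comp_proj_comp_single (Y : Module.End ℚ V) j₀,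
      ← proj_comp_sum_single_comp_comp_proj_comp_single (Z : Module.End ℚ V) j₀, h]
  have hsurj : Function.Surjective Δ := fun X => by
    have hX : (X : Module.End ℚ (ι → V)) ∈ (pi fun _ : ι => H).hodgeLie := by
      rw [← h𝔏']; exact X.2
    have hY : LinearMap.proj j₀ ∘ₗ (X : Module.End ℚ (ι → V)) ∘ₗ LinearMap.single ℚ (fun _ : ι => V) j₀ ∈ 𝔏 := by
      rw [← LieSubalgebra.mem_toSubmodule, h𝔏]
      exact proj_comp_single_mem_hodgeLie_pi (fun _ : ι => H) j₀ hX
    refine ⟨⟨_, hY⟩, Subtype.ext ?_⟩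
    rw [hΔ]
    exact (eq_sum_single_comp_comp_proj_of_mem_hodgeLie_pi_const H hX j₀).symm
  exact ⟨LieEquiv.ofBijective Δ ⟨hinj, hsurj⟩, fun Y => hΔ Y⟩

/-- **Simplicity of the Hodge Lie algebra does not change under `H ↦ H^{⊕ι}`** (`ι` finite nonempty): `𝔥(H)` is a simple
Lie algebra over `ℚ` iff `𝔥(⊕_ι H)` is. [cite: Moonen1999MTNotes, (1.7) and (1.8)] [cite: MoonenZarhin1999LowDim, §1] -/
theorem isSimple_iff_of_eq_hodgeLie_pi_const [Nonempty ι] :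
    letI : LieRing (Module.End ℚ V) := LieRing.ofAssociativeRing
    letI : LieRing (Module.End ℚ (ι → V)) := LieRing.ofAssociativeRing
    ∀ (𝔏 : LieSubalgebra ℚ (Module.End ℚ V)) (𝔏' : LieSubalgebra ℚ (Module.End ℚ (ι → V))),
      𝔏.toSubmodule = H.hodgeLie → 𝔏'.toSubmodule = (pi fun _ : ι => H).hodgeLie →
      (LieAlgebra.IsSimple ℚ 𝔏 ↔ LieAlgebra.IsSimple ℚ 𝔏') := by
  intro 𝔏 𝔏' h𝔏 h𝔏'
  obtain ⟨Δ, -⟩ := exists_lieEquiv_of_eq_hodgeLie_pi_const H 𝔏 𝔏' h𝔏 h𝔏'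
  exact ⟨fun _ => isSimple_of_lieEquiv Δ.symm, fun _ => isSimple_of_lieEquiv Δ⟩

/-- **Commutativity of the Hodge Lie algebra does not change under `H ↦ H^{⊕ι}`** (`ι` finite nonempty).
[cite: Moonen1999MTNotes, (1.7) and (1.8)] [cite: MoonenZarhin1999LowDim, §1] -/
theorem isLieAbelian_iff_of_eq_hodgeLie_pi_const [Nonempty ι] :
    letI : LieRing (Module.End ℚ V) := LieRing.ofAssociativeRing
    letI : LieRing (Module.End ℚ (ι → V)) := LieRing.ofAssociativeRing
    ∀ (𝔏 : LieSubalgebra ℚ (Module.End ℚ V)) (𝔏' : LieSubalgebra ℚ (Module.End ℚ (ι → V))),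
      𝔏.toSubmodule = H.hodgeLie → 𝔏'.toSubmodule = (pi fun _ : ι => H).hodgeLie →
      (IsLieAbelian 𝔏 ↔ IsLieAbelian 𝔏') := by
  intro 𝔏 𝔏' h𝔏 h𝔏'
  obtain ⟨Δ, -⟩ := exists_lieEquiv_of_eq_hodgeLie_pi_const H 𝔏 𝔏' h𝔏 h𝔏'
  exact ⟨fun h => Δ.symm.injective.isLieAbelian h, fun h => Δ.injective.isLieAbelian h⟩

end PiConst

end HodgeStructure

end Literature.AlgebraicGeometry.Motives

end
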